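import Summits.RiemannHypothesis.RiemannHypothesis.Theorems.MotivicDoorArchResidualThirdOrder
import HarnessLib

/-!
# Motivic door (Connes–Consani): the third-order dilation law of `N` in limit form

Honest framing (cell `pub-rhdoor`, cc-3, verbatim): "lottery ticket at the motivic door; RH
probability negligible; consolation prizes are real: a new semi-local Weil-positivity theorem, or a
located gap in the Connes–Consani programme, plus the ff-door theorem".  No RH content below;
value = theorem (pure real analysis of Bombieri's archimedean kernel).

`MotivicDoorArchResidualThirdOrder` proved `|K(t) − ¼ + t/48| ≤ t²/32` on `(0, 1]` for the
Hadamard kernel `K(t) = weilArchDensity t − 1/(2t)` of the decreed distribution `N` at `u = 1`,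
and the third-order dilation law of `N` for a real Weil test with an explicit window `ρ`.
This file removes the window from the statement (it is chosen inside the proof, as in
`tendsto_ccN_toMul_dilate_secondOrder`) and records the same order for the finite-part
remainder `r(δ)` of `finitePartCoeff_eq` / `finitePartRem_eq_integral`:

PROVED (RH-free, Suzuki-free, Weil-criterion-free):
* `abs_finitePartRem_sub_add_le_cube`: `|r(δ) − δ/4 + δ²/96| ≤ δ³/96` for `0 < δ ≤ 1`
  (`r(δ) = ∫₀^δ K = δ/4 − δ²/96 − δ³/96 + O(δ⁴)`, so the constant `1/96` is attained at `0⁺`).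
* `tendsto_finitePartRem_secondOrder`: `(r(δ) − δ/4)/δ² → −1/96` as `δ → 0⁺`.
* `tendsto_ccN_toMul_dilate_thirdOrder`: for EVERY real Weil test `φ`, as `ε → 0⁺`,
  `(N(toMul φ(·/ε)) − (½(γ + log 2π) + ½ log ε) φ(0) − [∫₁^∞ φ ds/(2s) − ∫₀¹ (φ(0) − φ) ds/(2s)]`
  `  − ε/4 ∫₀^∞ φ) / ε² → −(1/48) ∫₀^∞ s φ(s) ds = K′(0⁺) ∫₀^∞ s φ`.

So, for every real Weil test, the expansion of `N` against the dilates `φ(·/ε)` shrinking onto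
`u = 1` reads term by term: `½ log ε · φ(0)` (the pole `dt/(2t)`), then
`½(γ + log 2π) φ(0) + ½ Pf∫₀^∞ φ ds/s`, then `ε K(0⁺) ∫φ = ε/4 ∫φ`, then
`ε² K′(0⁺) ∫ sφ = −ε²/48 ∫ sφ`, with remainder `O(ε³ ∫ s²|φ|)`.

PRINTED (Connes, Essay, arXiv:1509.05576, p. 14 l. 45–57, eq. (27)): the archimedean part of `N`
is the distribution `∫₁^∞ κ(u) f(u) d*u = ∫₁^∞ (u² f(u) − f(1))/(u² − 1) d*u + c f(1)` (principal
value at `u = 1`; Connes–Consani arXiv:1805.10501 §3.1); the kernel `e^{t/2}/(2 sinh t)` is the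
archimedean density of Bombieri 2000, Thm 2.  READING (ours): the moments of a shrinking bump
against the Taylor coefficients of the bounded part `K` of that principal value give the dilation
expansion of `N` at `u = 1` term by term, for every test function; neither source states it; it
is elementary and RH-free.
NOT CLAIMED: anything about the zeros, `ω`, or positivity; nothing in this file bears on RH.
DATA: none (the exact Taylor coefficients `K = ¼ − t/48 − t²/32 + …` were cross-checked with
`fractions` arithmetic in the unit folder, `k_series_check.py`; no floating-point input to any
proof).
References: Bombieri 2000 (Thm 2); Connes, arXiv:1509.05576 §4.1 eq. (27); Connes–Consani,
arXiv:1805.10501 §3.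
-/

noncomputable section

set_option linter.dupNamespace false

open Complex Set MeasureTheory Filter Topology Literature.NumberTheory.LFunctions
open Literature.NumberTheory.ConnesConsani2019
open Summit.RiemannHypothesis.RiemannHypothesis.Theorems.MotivicDoor.ArchLogLaplacian
open scoped Real

namespace Summit.RiemannHypothesis.RiemannHypothesis.Theorems.MotivicDoor.ConnesConsani

variable {φ : ℝ → ℝ}

/-! ## 1. The finite-part remainder to third order -/

/-- `K = w − 1/(2t)` is integrable on every `(0, d]` (`|K| ≤ ¼` on `(0, ∞)`). -/
private theorem tl_integrableOn_Ioc {d : ℝ} :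
    IntegrableOn (fun t ↦ weilArchDensity t - 1 / (2 * t)) (Ioc 0 d) :=
  Measure.integrableOn_of_bounded (M := 1 / 4) measure_Ioc_lt_top.ne
    (measurable_weilArchDensity.sub (measurable_const.div
      (measurable_const.mul measurable_id))).aestronglyMeasurable (by
      filter_upwards [ae_restrict_mem measurableSet_Ioc] with t ht
      exact (Real.norm_eq_abs _).trans_le (abs_weilArchDensity_sub_inv_le ht.1))

/-- **The finite-part remainder to third order**: `|r(δ) − δ/4 + δ²/96| ≤ δ³/96` for
`0 < δ ≤ 1`, `r` the remainder of `finitePartCoeff_eq` (`r(δ) = ∫₀^δ K` by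
`finitePartRem_eq_integral`, and `|K − ¼ + t/48| ≤ t²/32`).  The constant `1/96` is the Taylor
coefficient (`r = δ/4 − δ²/96 − δ³/96 + O(δ⁴)`), hence sharp.  PROVED. -/
theorem abs_finitePartRem_sub_add_le_cube {δ : ℝ} (hδ : 0 < δ) (hδ1 : δ ≤ 1) :
    |(∫ t in Ioc 0 δ, (Real.exp (t / 2) - 1) / (2 * Real.sinh t)) +
        1 / 2 * (Real.log (Real.sinh (δ / 2)) - Real.log (Real.cosh (δ / 2)) -
          Real.log (δ / 2)) - δ / 4 + δ ^ 2 / 96| ≤ δ ^ 3 / 96 := by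
  have hc : IntegrableOn (fun _ : ℝ ↦ (1 / 4 : ℝ)) (Ioc 0 δ) := continuous_const.integrableOn_Ioc
  have hl : IntegrableOn (fun t : ℝ ↦ t / 48) (Ioc 0 δ) :=
    (continuous_id.div_const (48 : ℝ)).integrableOn_Ioc
  have hmod : IntegrableOn (fun t : ℝ ↦ 1 / 4 - t / 48) (Ioc 0 δ) := hc.sub hl
  have h3i : IntegrableOn (fun t : ℝ ↦ t ^ 2 / 32) (Ioc 0 δ) :=
    ((continuous_pow 2).div_const (32 : ℝ)).integrableOn_Ioc
  have hq : ∫ t in Ioc 0 δ, (1 / 4 - t / 48 : ℝ) = δ / 4 - δ ^ 2 / 96 := by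
    rw [integral_sub hc hl, setIntegral_const, Real.volume_real_Ioc_of_le hδ.le, smul_eq_mul,
      ← intervalIntegral.integral_of_le hδ.le, intervalIntegral.integral_div, integral_id]
    ring
  have h3 : ∫ t in Ioc 0 δ, t ^ 2 / 32 = δ ^ 3 / 96 := by
    rw [← intervalIntegral.integral_of_le hδ.le, intervalIntegral.integral_div, integral_pow]
    norm_num [div_div]
  rw [finitePartRem_eq_integral hδ hδ1, sub_add, ← hq, ← integral_sub tl_integrableOn_Ioc hmod,
    ← h3]
  refine (Real.norm_eq_abs _).symm.trans_le (norm_integral_le_of_norm_le h3i ?_)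
  filter_upwards [ae_restrict_mem measurableSet_Ioc] with t ht
  rw [Real.norm_eq_abs, ← sub_add]
  exact abs_weilArchDensity_sub_inv_sub_quarter_add_le ht.1 (ht.2.trans hδ1)

/-- **Limit form**: `(r(δ) − δ/4)/δ² → −1/96` as `δ → 0⁺` — after the slope `K(0⁺) = ¼`
(`abs_finitePartRem_sub_le_sq`), the curvature of the finite-part remainder at `0⁺` is
`K′(0⁺)/2 = −1/96`.  PROVED. -/
theorem tendsto_finitePartRem_secondOrder :
    Tendsto (fun δ ↦ ((∫ t in Ioc 0 δ, (Real.exp (t / 2) - 1) / (2 * Real.sinh t)) +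
        1 / 2 * (Real.log (Real.sinh (δ / 2)) - Real.log (Real.cosh (δ / 2)) -
          Real.log (δ / 2)) - δ / 4) / δ ^ 2) (𝓝[>] 0) (𝓝 (-(1 / 96))) := by
  have hb : Tendsto (fun δ : ℝ ↦ δ * (1 / 96)) (𝓝[>] 0) (𝓝 0) := by
    simpa only [zero_mul, id_eq] using ((tendsto_id : Tendsto (id : ℝ → ℝ) (𝓝 0)
      (𝓝 0)).mono_left nhdsWithin_le_nhds).mul_const (1 / 96)
  rw [← tendsto_sub_nhds_zero_iff]
  refine squeeze_zero_norm' ?_ hb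
  filter_upwards [Ioc_mem_nhdsGT one_pos] with δ hδ
  have hδ2 : δ ^ 2 ≠ 0 := pow_ne_zero 2 hδ.1.ne'
  have e : ∀ r : ℝ, (r - δ / 4) / δ ^ 2 - -(1 / 96) = (r - δ / 4 + δ ^ 2 / 96) / δ ^ 2 :=
    fun r ↦ by
    rw [eq_div_iff hδ2, sub_mul, div_mul_cancel₀ _ hδ2]
    ring
  rw [Real.norm_eq_abs, e, abs_div, abs_of_pos (pow_pos hδ.1 2), div_le_iff₀ (pow_pos hδ.1 2)]
  calc _ ≤ δ ^ 3 / 96 := abs_finitePartRem_sub_add_le_cube hδ.1 hδ.2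
    _ = δ * (1 / 96) * δ ^ 2 := by ring

/-! ## 2. The third-order dilation law of `N` at `u = 1`, for every real Weil test -/

/-- **Third-order dilation law, limit form**: for EVERY real Weil test `φ`, as `ε → 0⁺`,
`(N(toMul φ(·/ε)) − (½(γ + log 2π) + ½ log ε) φ(0) − [∫₁^∞ φ ds/(2s) − ∫₀¹ (φ(0) − φ) ds/(2s)]`
`  − ε/4 ∫₀^∞ φ) / ε² → −(1/48) ∫₀^∞ s φ(s) ds = K′(0⁺) ∫₀^∞ s φ`
(the window `ρ = R + 1` of `abs_ccN_toMul_dilate_sub_third_le` is chosen inside the proof).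
PROVED. -/
theorem tendsto_ccN_toMul_dilate_thirdOrder (hφ : IsWeilTest fun t ↦ (φ t : ℂ)) :
    Tendsto (fun ε ↦ (ccN (toMul fun t ↦ φ (t / ε)) -
        (((Real.eulerMascheroniConstant + Real.log (2 * π)) / 2 + Real.log ε / 2) * φ 0 +
            ((∫ s in Ioi 1, φ s / (2 * s)) - ∫ s in Ioc 0 1, (φ 0 - φ s) / (2 * s)) +
          ε / 4 * ∫ s in Ioi 0, φ s)) / ε ^ 2)
      (𝓝[>] 0) (𝓝 (-(1 / 48) * ∫ s in Ioi 0, s * φ s)) := by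
  obtain ⟨R, hR0, hR⟩ := exists_eq_zero_of_lt_abs_of_isWeilTest hφ
  have hρ : ∀ t, R + 1 ≤ |t| → φ t = 0 := fun t ht ↦ hR t (by linarith)
  have hb : Tendsto (fun ε : ℝ ↦ ε * (1 / 32 * ∫ s in Ioi 0, s ^ 2 * |φ s|)) (𝓝[>] 0)
      (𝓝 0) := by
    simpa only [zero_mul, id_eq] using ((tendsto_id : Tendsto (id : ℝ → ℝ) (𝓝 0)
      (𝓝 0)).mono_left nhdsWithin_le_nhds).mul_const (1 / 32 * ∫ s in Ioi 0, s ^ 2 * |φ s|)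
  rw [← tendsto_sub_nhds_zero_iff]
  refine squeeze_zero_norm' ?_ hb
  have hm : (0 : ℝ) < min 1 (1 / (2 * (R + 1))) := lt_min one_pos (by positivity)
  filter_upwards [Ioc_mem_nhdsGT hm] with ε hε
  have hε2 : ε ^ 2 ≠ 0 := pow_ne_zero 2 hε.1.ne'
  have hε1 : ε ≤ 1 := hε.2.trans (min_le_left _ _)
  have hερ : ε * (R + 1) ≤ 1 / 2 := by
    have h := hε.2.trans (min_le_right _ _); rw [le_div_iff₀ (by positivity)] at h; linarith
  have h := abs_ccN_toMul_dilate_sub_third_le hφ hρ hε.1 hε1 hερ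
  have e : ∀ N F I J : ℝ, (N - (F + ε / 4 * I)) / ε ^ 2 - -(1 / 48) * J =
      (N - (F + (ε / 4 * I - ε ^ 2 / 48 * J))) / ε ^ 2 := fun N F I J ↦ by
    rw [eq_div_iff hε2, sub_mul, div_mul_cancel₀ _ hε2]
    ring
  rw [Real.norm_eq_abs, e, abs_div, abs_of_pos (pow_pos hε.1 2), div_le_iff₀ (pow_pos hε.1 2)]
  calc _ ≤ _ := h
    _ = ε * (1 / 32 * ∫ s in Ioi 0, s ^ 2 * |φ s|) * ε ^ 2 := by ring

end Summit.RiemannHypothesis.RiemannHypothesis.Theorems.MotivicDoor.ConnesConsani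

end
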